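import Mathlib.Analysis.SpecialFunctions.Complex.Arg
import Literature.Probability.LatticeModels.LatticeLoopWinding
import HarnessLib

/-!
# Closed walks on the triangular lattice: winding numbers about triangle centroids (definitions)

Support file (definitions only, plus their unfolding lemmas) for the registered stub
`stub_pickParity` of line `charged-uncharged` of crux `ZeroOneTransfer` (stmt-ValiantsHypothesis-5066,
route DivisionGap): Pick's theorem mod 4 for simple closed walks on the TRIANGULAR lattice — the
lattice-topology input of Kasteleyn's theorem for Valiant's rhombus dimers `D_n` (`IsVPFamily_ℂ (D_n)`,
the hypothesis `hVP` of `ZeroOneTransfer.Negative.zeroOneTransfer_false_of_triangularDimers_hard`).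
Proofs live in `Theorems/DivisionGapZeroOneTransferStubPickParity*.lean`.

The triangular lattice is drawn on `ℤ²` with the antidiagonals: unit steps `±(1,0)`, `±(0,1)`,
`±(1,-1)`; its faces are the two triangles `T₁(a,b) = {(a,b),(a+1,b),(a,b+1)}` (lower left) and
`T₂(a,b) = {(a+1,b),(a+1,b+1),(a,b+1)}` (upper right) of each unit square `(a,b)`.  Everything is the
triangular analogue of `Literature/Probability/LatticeModels/LatticeLoopWinding.lean` (square
lattice, Kenyon 2009 §3.3), whose indicator `indZ` we reuse:

* `TriWalk ℓ` — a closed walk `v : ℕ → ℤ × ℤ` of period `ℓ` with triangular-lattice unit steps;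
* `W₁ c a b`, `W₂ c a b` — the WINDING NUMBERS of the walk about the centroids `(a+⅓, b+⅓)` of
  `T₁(a,b)` and `(a+⅔, b+⅔)` of `T₂(a,b)`: signed crossings of the horizontal ray to the right of the
  centroid (a vertical step at abscissa `x` crosses it iff `a < x`; the antidiagonal of the square
  with left column `x` crosses the first iff `a ≤ x` and the second iff `a + 1 ≤ x` — whence the
  `max`/`min` of the abscissae of the step);
* `cnt c P Q` — the number of traversals of the directed edge `P → Q` in one period;
* `shoelace c` — `Σ_j (x_j y_{j+1} - x_{j+1} y_j)`, twice the signed area;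
* `faceSum c u` — the ANGLE-WEIGHTED sum (unit `45°`: weights `2,2,1,1,1,1`, total `8`) of the winding
  numbers of the six triangles around the lattice point `u`;
* `turn d e` — the exterior angle, in units of `45°`, between consecutive steps `d`, `e`
  (`∈ {0, ±1, ±2, ±3}`; `sign (d × e) · (2 - sign (d · e))`);
* `Wrf c p q` — the winding number of the triangle immediately to the RIGHT of the step `p → q`;
* `vtx c` — the vertex sequence as a `ℤ`-indexed family of complex numbers (the format of the tree's
  polygonal Umlaufsatz `Literature.Topology.PlaneTopology.IsSimplePolygon.sum_extAngle_eq`).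
[cite: Kasteleyn1961] [cite: Kenyon2009, §3.3]
-/

namespace Summit.ValiantsHypothesis.ValiantsHypothesis.Theorems.DivisionGapZeroOneTransfer

-- the single-problem summit's namespace `Summit.ValiantsHypothesis.ValiantsHypothesis` repeats
set_option linter.dupNamespace false

open Finset Literature.Probability.LatticeModels

/-- A **closed walk on the triangular lattice** of period `ℓ`: a map `v : ℕ → ℤ²` with
`v (j + ℓ) = v j` whose steps `v j → v (j + 1)` are among `±(1,0)`, `±(0,1)`, `±(1,-1)` (written
exactly as in the registered stub `stub_pickParity`). [folklore] -/
structure TriWalk (ℓ : ℕ) where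
  /-- the vertices, indexed periodically -/
  v : ℕ → ℤ × ℤ
  /-- periodicity -/
  periodic : ∀ j, v (j + ℓ) = v j
  /-- consecutive vertices are triangular-lattice neighbours -/
  step : ∀ j, v (j + 1) = v j + (1, 0) ∨ v j = v (j + 1) + (1, 0) ∨ v (j + 1) = v j + (0, 1) ∨
    v j = v (j + 1) + (0, 1) ∨ v (j + 1) = v j + (1, -1) ∨ v j = v (j + 1) + (1, -1)

namespace TriWalk

variable {ℓ : ℕ} (c : TriWalk ℓ)

/-- **Winding number about the centroid of the lower-left triangle** `T₁(a,b)` of the unit square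
`(a,b)`: `Σ_{j<ℓ} [a < max (x_j, x_{j+1})] ([b < y_{j+1}] - [b < y_j])`. [cite: Kenyon2009, §3.3] -/
def W₁ (a b : ℤ) : ℤ :=
  ∑ j ∈ range ℓ, indZ (a < max (c.v j).1 (c.v (j + 1)).1) *
    (indZ (b < (c.v (j + 1)).2) - indZ (b < (c.v j).2))

/-- **Winding number about the centroid of the upper-right triangle** `T₂(a,b)` of the unit square
`(a,b)`: `Σ_{j<ℓ} [a < min (x_j, x_{j+1})] ([b < y_{j+1}] - [b < y_j])`. [cite: Kenyon2009, §3.3] -/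
def W₂ (a b : ℤ) : ℤ :=
  ∑ j ∈ range ℓ, indZ (a < min (c.v j).1 (c.v (j + 1)).1) *
    (indZ (b < (c.v (j + 1)).2) - indZ (b < (c.v j).2))

/-- The number of traversals of the directed edge `P → Q` in one period. [folklore] -/
def cnt (P Q : ℤ × ℤ) : ℤ :=
  ∑ j ∈ range ℓ, indZ (c.v j = P ∧ c.v (j + 1) = Q)

/-- The **shoelace sum** `Σ_{j<ℓ} (x_j y_{j+1} - x_{j+1} y_j)` of the walk (twice its signed area;
the sum of the winding numbers of all triangles). [folklore] -/
def shoelace : ℤ :=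
  ∑ j ∈ range ℓ, ((c.v j).1 * (c.v (j + 1)).2 - (c.v (j + 1)).1 * (c.v j).2)

/-- The **angle-weighted sum of the winding numbers of the six triangles around the lattice point**
`u = (a,b)` (unit `45°`; the right angles of `T₁(a,b)` and `T₂(a-1,b-1)` sit at `u`, the four
other triangles `T₁(a-1,b)`, `T₁(a,b-1)`, `T₂(a-1,b)`, `T₂(a,b-1)` have a `45°` angle at `u`). [folklore] -/
def faceSum (u : ℤ × ℤ) : ℤ :=
  2 * c.W₁ u.1 u.2 + 2 * c.W₂ (u.1 - 1) (u.2 - 1) + c.W₁ (u.1 - 1) u.2 + c.W₁ u.1 (u.2 - 1) +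
    c.W₂ (u.1 - 1) u.2 + c.W₂ u.1 (u.2 - 1)

/-- The winding number of the triangle immediately to the **right** of the unit step `p → q`
(by cases on `q - p`: `(1,0) ↦ T₂(p₁, p₂-1)`, `(0,1) ↦ T₁(p)`, `(-1,1) ↦ T₂(p₁-1, p₂)`,
`(-1,0) ↦ T₁(p₁-1, p₂)`, `(0,-1) ↦ T₂(p₁-1, p₂-1)`, `(1,-1) ↦ T₁(p₁, p₂-1)`). [folklore] -/
def Wrf (p q : ℤ × ℤ) : ℤ :=
  if q - p = (1, 0) then c.W₂ p.1 (p.2 - 1)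
  else if q - p = (0, 1) then c.W₁ p.1 p.2
  else if q - p = (-1, 1) then c.W₂ (p.1 - 1) p.2
  else if q - p = (-1, 0) then c.W₁ (p.1 - 1) p.2
  else if q - p = (0, -1) then c.W₂ (p.1 - 1) (p.2 - 1)
  else c.W₁ p.1 (p.2 - 1)

/-- The vertex sequence as a `ℤ`-periodic family of complex numbers `x_i + y_i·I` (the input format
of `Literature.Topology.PlaneTopology.IsSimplePolygon`). [folklore] -/
noncomputable def vtx (i : ℤ) : ℂ :=
  ⟨((c.v (i % ℓ).toNat).1 : ℝ), ((c.v (i % ℓ).toNat).2 : ℝ)⟩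

end TriWalk

/-- The **exterior angle in units of `45°`** between consecutive unit steps `d` and `e` of the
triangular lattice: `sign (d × e) · (2 - sign (d · e))`, i.e. `0` if `e = d`, `±1`, `±2`, `±3` for a
left/right turn by `45°`, `90°`, `135°` (positive = counter-clockwise). [folklore] -/
def turn (d e : ℤ × ℤ) : ℤ :=
  Int.sign (d.1 * e.2 - d.2 * e.1) * (2 - Int.sign (d.1 * e.1 + d.2 * e.2))

/-! ### Unfolding lemmas -/

namespace TriWalk

variable {ℓ : ℕ} (c : TriWalk ℓ)

/-- Unfolding `W₁`. [folklore] -/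
theorem W₁_def (a b : ℤ) : c.W₁ a b = ∑ j ∈ range ℓ, indZ (a < max (c.v j).1 (c.v (j + 1)).1) *
    (indZ (b < (c.v (j + 1)).2) - indZ (b < (c.v j).2)) := rfl

/-- Unfolding `W₂`. [folklore] -/
theorem W₂_def (a b : ℤ) : c.W₂ a b = ∑ j ∈ range ℓ, indZ (a < min (c.v j).1 (c.v (j + 1)).1) *
    (indZ (b < (c.v (j + 1)).2) - indZ (b < (c.v j).2)) := rfl

/-- Unfolding `cnt`. [folklore] -/
theorem cnt_def (P Q : ℤ × ℤ) : c.cnt P Q = ∑ j ∈ range ℓ, indZ (c.v j = P ∧ c.v (j + 1) = Q) := rfl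

/-- Unfolding `shoelace`. [folklore] -/
theorem shoelace_def : c.shoelace =
    ∑ j ∈ range ℓ, ((c.v j).1 * (c.v (j + 1)).2 - (c.v (j + 1)).1 * (c.v j).2) := rfl

/-- Unfolding `faceSum`. [folklore] -/
theorem faceSum_def (u : ℤ × ℤ) : c.faceSum u =
    2 * c.W₁ u.1 u.2 + 2 * c.W₂ (u.1 - 1) (u.2 - 1) + c.W₁ (u.1 - 1) u.2 + c.W₁ u.1 (u.2 - 1) +
      c.W₂ (u.1 - 1) u.2 + c.W₂ u.1 (u.2 - 1) := rfl

/-- Unfolding `Wrf`. [folklore] -/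
theorem Wrf_def (p q : ℤ × ℤ) : c.Wrf p q =
    if q - p = (1, 0) then c.W₂ p.1 (p.2 - 1)
    else if q - p = (0, 1) then c.W₁ p.1 p.2
    else if q - p = (-1, 1) then c.W₂ (p.1 - 1) p.2
    else if q - p = (-1, 0) then c.W₁ (p.1 - 1) p.2
    else if q - p = (0, -1) then c.W₂ (p.1 - 1) (p.2 - 1)
    else c.W₁ p.1 (p.2 - 1) := rfl

/-- Unfolding `vtx`. [folklore] -/
theorem vtx_def (i : ℤ) :
    c.vtx i = ⟨((c.v (i % ℓ).toNat).1 : ℝ), ((c.v (i % ℓ).toNat).2 : ℝ)⟩ := rfl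

end TriWalk

/-- Unfolding `turn` (registered sub-goal `turn_def` of stmt-ValiantsHypothesis-5066, the handle
under which this vocabulary file supports the crux item). [folklore] -/
theorem turn_def : ∀ (d e : ℤ × ℤ), Summit.ValiantsHypothesis.ValiantsHypothesis.Theorems.DivisionGapZeroOneTransfer.turn d e = Int.sign (d.1 * e.2 - d.2 * e.1) * (2 - Int.sign (d.1 * e.1 + d.2 * e.2)) :=
  fun _ _ => rfl

end Summit.ValiantsHypothesis.ValiantsHypothesis.Theorems.DivisionGapZeroOneTransfer
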